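import Summits.PneNP.PneNP.Theorems.SoloBlindStreamingFooling
import HarnessLib

/-!
# The repetition ("boxes") bound for one-pass streaming algorithms

A word-level lower-bound tool for the ONE-PASS STREAMING model of the tree
(`StreamingAlgorithm`, space on runs `RunsInSpace`, classes `STREAM` / `USTREAM`), companion to
the fooling-set bound `card_lt_two_pow_of_fooling` of `SoloBlindStreamingFooling`.

**Theorem (`card_pow_le_of_replicate_mem`).** Let `A` decide `L` with every state reached on a
prefix of an input of length `N` of length `≤ S N`, let `N = R · ℓ` with `R ≥ 1`, let `F` be a
finite set of words of length `ℓ` such that the `R`-fold repetition `u^R = u ++ ⋯ ++ u` of every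
`u ∈ F` lies in `L`, and let `Y` contain every word of `L` of length `N`. Then

  `|F| ^ R ≤ |Y| · (2 ^ (S N + 1)) ^ (R · (R - 1))`.

In words: if `L` has few YES-instances of length `N` but many "diagonal" YES-instances `u^R`, a
one-pass algorithm needs space about `(log |F| - (log |Y|) / R) / (R - 1)`.

Proof. Pin the states: by `R - 1` pigeonhole steps (`exists_fiber_of_length_le`, each losing a
factor `2^(S N + 1)` since states are words of length `≤ S N`) there is `D ⊆ F` with
`|F| ≤ |D| · 2^((S N + 1)(R - 1))` on which, for every `i ≤ R - 1`, the state reached after `q^i`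
is the same for all `q ∈ D` (`exists_agreeing_subset`). By induction along the blocks
(`reach_flatten_eq_of_agree`) the state after ANY concatenation `b₁ ⋯ b_i` of blocks from `D` is
that common state, so `b₁ ⋯ b_R` is accepted iff `b_R^R` is, i.e. always: all `|D|^R` such words
(distinct, `flatten_injective_of_length_eq`) lie in `Y`. Hence `|D|^R ≤ |Y|` and the bound
follows. No uniformity and no time bound is used.

This is the abstract half of THEOREM H of the solo programme (`SoloBlindStreamingMCSPSpace`:
every one-pass streaming algorithm for `MCSP[s]` needs space `Ω(s log s)` infinitely often),
which calibrates the information-theoretic content of the McKay–Murray–Williams streaming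
hypothesis `StreamingLowerBound`.

References: the argument is a folklore "product / direct-sum" pigeonhole for one-way protocols;
cf. [AroraBarak2009, §13.1] for the two-block (fooling-set) case. [folklore]
-/

namespace Summit.PneNP.PneNP.Theorems.SoloBlind

open Computability
open Literature.Computability.Complexity Literature.Computability.MetaComplexity
open Literature.Computability.MetaComplexity.McKayMurrayWilliams2019

/-! ### Repetitions and concatenations of equal-length blocks -/

/-- The length of the `R`-fold repetition `u^R`. [folklore] -/
theorem length_flatten_replicate (R : ℕ) (u : List Bool) :
    (List.replicate R u).flatten.length = R * u.length := by
  induction R with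
  | zero => simp
  | succ R ih => simp [List.replicate_succ, ih]; ring

/-- `u^(R+1) = u^R ++ u`. [folklore] -/
theorem flatten_replicate_succ (R : ℕ) (u : List Bool) :
    (List.replicate (R + 1) u).flatten = (List.replicate R u).flatten ++ u := by
  rw [List.replicate_succ', List.flatten_append]
  simp

/-- The length of a concatenation of blocks of a common length `ℓ`. [folklore] -/
theorem length_flatten_of_forall_length_eq {ℓ : ℕ} :
    ∀ l : List (List Bool), (∀ b ∈ l, b.length = ℓ) → l.flatten.length = l.length * ℓ
  | [], _ => by simp
  | b :: t, h => by
      have hb : b.length = ℓ := h b (by simp)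
      have ht : t.flatten.length = t.length * ℓ :=
        length_flatten_of_forall_length_eq t fun b' hb' => h b' (by simp [hb'])
      simp only [List.flatten_cons, List.length_append, hb, ht, List.length_cons]
      ring

/-- Concatenation is injective on lists of the same number of blocks of a common length `ℓ`.
[folklore] -/
theorem flatten_injective_of_length_eq {ℓ : ℕ} :
    ∀ l₁ l₂ : List (List Bool), (∀ b ∈ l₁, b.length = ℓ) → (∀ b ∈ l₂, b.length = ℓ) →
      l₁.length = l₂.length → l₁.flatten = l₂.flatten → l₁ = l₂
  | [], [], _, _, _, _ => rfl
  | [], _ :: _, _, _, h, _ => by simp at h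
  | _ :: _, [], _, _, h, _ => by simp at h
  | b₁ :: t₁, b₂ :: t₂, h₁, h₂, hl, he => by
      simp only [List.flatten_cons] at he
      have hb₁ : b₁.length = ℓ := h₁ b₁ (by simp)
      have hb₂ : b₂.length = ℓ := h₂ b₂ (by simp)
      obtain ⟨hb, ht⟩ := List.append_inj he (by rw [hb₁, hb₂])
      rw [hb, flatten_injective_of_length_eq t₁ t₂ (fun b hb' => h₁ b (by simp [hb']))
        (fun b hb' => h₂ b (by simp [hb'])) (by simpa using hl) ht]

/-! ### Pinning the states -/

/-- **Fiber step.** A map on a nonempty finite set whose values are words of length `≤ s` has a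
fiber containing at least a `2^{-(s+1)}` fraction of the set (there are fewer than `2^(s+1)`
values, `card_lt_two_pow_of_length_le`). [folklore (pigeonhole)] -/
theorem exists_fiber_of_length_le {α : Type*} (C : Finset α) (hC : C.Nonempty)
    (g : α → List Bool) {s : ℕ} (hg : ∀ q ∈ C, (g q).length ≤ s) :
    ∃ t : List Bool, C.card ≤ (C.filter fun q => g q = t).card * 2 ^ (s + 1) := by
  obtain ⟨q₀, -, hmax⟩ :=
    Finset.exists_max_image C (fun q => (C.filter fun q' => g q' = g q).card) hC
  refine ⟨g q₀, ?_⟩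
  have h1 : C.card ≤ (C.filter fun q' => g q' = g q₀).card * (C.image g).card := by
    have h := Finset.card_le_mul_card_image (f := g) C ((C.filter fun q' => g q' = g q₀).card)
      (fun t ht => by
        obtain ⟨q, hq, rfl⟩ := Finset.mem_image.1 ht
        exact hmax q hq)
    simpa [Nat.mul_comm] using h
  have h2 : (C.image g).card < 2 ^ (s + 1) :=
    card_lt_two_pow_of_length_le _ fun w hw => by
      obtain ⟨q, hq, rfl⟩ := Finset.mem_image.1 hw
      exact hg q hq
  exact h1.trans (Nat.mul_le_mul_left _ h2.le)

/-- **Nested fibers.** If all words of `F` have length `ℓ` and `R · ℓ = N`, then for every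
`j ≤ R - 1` there is a nonempty `D ⊆ F` with `|F| ≤ |D| · (2^(S N + 1))^j` such that for every
`i ≤ j` the state reached (at input length `N`) after the `i`-fold repetition `q^i` is the same
for all `q ∈ D`. [folklore (pigeonhole)] -/
theorem exists_agreeing_subset {A : StreamingAlgorithm} {S : ℕ → ℕ} (hS : RunsInSpace A S)
    {N R ℓ : ℕ} (hN : R * ℓ = N) (F : Finset (List Bool)) (hF : F.Nonempty)
    (hlen : ∀ u ∈ F, u.length = ℓ) :
    ∀ j, j + 1 ≤ R → ∃ D : Finset (List Bool), D ⊆ F ∧ D.Nonempty ∧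
      F.card ≤ D.card * (2 ^ (S N + 1)) ^ j ∧
      ∀ i, i ≤ j → ∀ q ∈ D, ∀ q' ∈ D,
        reach A N (List.replicate i q).flatten = reach A N (List.replicate i q').flatten := by
  intro j
  induction j with
  | zero =>
    intro _
    refine ⟨F, Finset.Subset.refl _, hF, by simp, ?_⟩
    intro i hi q _ q' _
    obtain rfl : i = 0 := Nat.le_zero.1 hi
    simp
  | succ j ih =>
    intro hj
    obtain ⟨D, hDF, hDne, hcard, hagree⟩ := ih (by omega)
    obtain ⟨t, ht⟩ := exists_fiber_of_length_le D hDne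
      (fun q => reach A N (List.replicate (j + 1) q).flatten) (s := S N) (fun q hq => by
        apply hS
        rw [length_flatten_replicate, hlen q (hDF hq), ← hN]
        exact Nat.mul_le_mul_right _ (by omega))
    have hsub : (D.filter fun q => reach A N (List.replicate (j + 1) q).flatten = t) ⊆ D :=
      Finset.filter_subset _ _
    refine ⟨D.filter fun q => reach A N (List.replicate (j + 1) q).flatten = t,
      hsub.trans hDF, ?_, ?_, ?_⟩
    · rw [← Finset.card_pos]
      have hDpos : 0 < D.card := Finset.card_pos.2 hDne
      rcases Nat.eq_zero_or_pos
        (D.filter fun q => reach A N (List.replicate (j + 1) q).flatten = t).card with h0 | h0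
      · rw [h0, zero_mul] at ht; omega
      · exact h0
    · calc F.card ≤ D.card * (2 ^ (S N + 1)) ^ j := hcard
        _ ≤ ((D.filter fun q => reach A N (List.replicate (j + 1) q).flatten = t).card *
              2 ^ (S N + 1)) * (2 ^ (S N + 1)) ^ j := Nat.mul_le_mul_right _ ht
        _ = (D.filter fun q => reach A N (List.replicate (j + 1) q).flatten = t).card *
              (2 ^ (S N + 1)) ^ (j + 1) := by rw [pow_succ]; ring
    · intro i hi q hq q' hq'
      rcases Nat.lt_or_ge i (j + 1) with hlt | hge
      · exact hagree i (by omega) q (hsub hq) q' (hsub hq')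
      · obtain rfl : i = j + 1 := le_antisymm hi hge
        rw [(Finset.mem_filter.1 hq).2, (Finset.mem_filter.1 hq').2]

/-- **Chain.** If for every `i ≤ m` the state after `q^i` is the same for all `q ∈ D`, then the
state after any concatenation of at most `m` blocks from `D` is that common state. [folklore] -/
theorem reach_flatten_eq_of_agree {A : StreamingAlgorithm} {N m : ℕ} {D : Finset (List Bool)}
    (hagree : ∀ i, i ≤ m → ∀ q ∈ D, ∀ q' ∈ D,
      reach A N (List.replicate i q).flatten = reach A N (List.replicate i q').flatten)
    {q₀ : List Bool} (hq₀ : q₀ ∈ D) :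
    ∀ l : List (List Bool), (∀ b ∈ l, b ∈ D) → l.length ≤ m →
      reach A N l.flatten = reach A N (List.replicate l.length q₀).flatten := by
  intro l
  induction l using List.reverseRecOn with
  | nil => intro _ _; simp
  | append_singleton l b ih =>
    intro hmem hl
    have hb : b ∈ D := hmem b (by simp)
    have hl' : l.length + 1 ≤ m := by simpa using hl
    have e : (l ++ [b]).flatten = l.flatten ++ b := by simp
    rw [e, reach_append, ih (fun b' hb' => hmem b' (by simp [hb'])) (by omega),
      hagree l.length (by omega) q₀ hq₀ b hb, ← reach_append, ← flatten_replicate_succ,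
      List.length_append, List.length_singleton, hagree (l.length + 1) hl' b hb q₀ hq₀]

/-! ### The bound -/

/-- **The repetition ("boxes") bound.** If `A` decides `L` in space `S` on runs, `N = R · ℓ`
with `R ≥ 1`, every `u ∈ F` has length `ℓ` and satisfies `u^R ∈ L`, and `Y` contains every word
of `L` of length `N`, then `|F|^R ≤ |Y| · (2^(S N + 1))^(R(R-1))`. No uniformity or time bound
is used. [folklore (product / direct-sum pigeonhole for one-way protocols); cf. AroraBarak2009,
§13.1 for `R = 2`] -/
theorem card_pow_le_of_replicate_mem {A : StreamingAlgorithm} {S : ℕ → ℕ} {L : Language Bool}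
    (hS : RunsInSpace A S) (hL : A.Decides L) {N R ℓ : ℕ} (hR : 1 ≤ R) (hN : R * ℓ = N)
    (F Y : Finset (List Bool)) (hlen : ∀ u ∈ F, u.length = ℓ)
    (hyes : ∀ u ∈ F, (List.replicate R u).flatten ∈ L)
    (hY : ∀ w ∈ L, w.length = N → w ∈ Y) :
    F.card ^ R ≤ Y.card * (2 ^ (S N + 1)) ^ (R * (R - 1)) := by
  obtain ⟨R, rfl⟩ : ∃ R', R = R' + 1 := ⟨R - 1, by omega⟩
  simp only [Nat.add_sub_cancel]
  rcases F.eq_empty_or_nonempty with hF | hF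
  · subst hF; simp
  obtain ⟨D, hDF, ⟨q₀, hq₀⟩, hcard, hagree⟩ :=
    exists_agreeing_subset hS hN F hF hlen R le_rfl
  -- every concatenation of `R + 1` blocks from `D` is a YES-instance
  have hmemL : ∀ l : List (List Bool), (∀ b ∈ l, b ∈ D) → l.length = R + 1 →
      l.flatten ∈ L := by
    intro l
    induction l using List.reverseRecOn with
    | nil => intro _ h; simp at h
    | append_singleton l b _ =>
      intro hmem hl
      have hb : b ∈ D := hmem b (by simp)
      have hlD : ∀ b' ∈ l, b' ∈ D := fun b' hb' => hmem b' (by simp [hb'])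
      have hl' : l.length = R := by simpa using hl
      have e : (l ++ [b]).flatten = l.flatten ++ b := by simp
      have e1 : reach A N l.flatten = reach A N (List.replicate R b).flatten := by
        rw [reach_flatten_eq_of_agree hagree hq₀ l hlD hl'.le, hl']
        exact hagree R le_rfl q₀ hq₀ b hb
      have hlast : (List.replicate R b).flatten ++ b ∈ L := by
        rw [← flatten_replicate_succ]; exact hyes b (hDF hb)
      have hlen1 : (l.flatten ++ b).length = N := by
        rw [List.length_append, length_flatten_of_forall_length_eq l
          (fun b' hb' => hlen b' (hDF (hlD b' hb'))), hl', hlen b (hDF hb), ← hN]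
        ring
      have hlen2 : ((List.replicate R b).flatten ++ b).length = N := by
        rw [List.length_append, length_flatten_replicate, hlen b (hDF hb), ← hN]
        ring
      rw [e]
      exact (mem_iff_of_reach_eq hL hlen1 hlen2 e1).2 hlast
  -- the blocks of a tuple from `D`
  have hblk : ∀ f : Fin (R + 1) → List Bool, (∀ i, f i ∈ D) → ∀ b ∈ List.ofFn f, b ∈ D := by
    intro f hf b hb
    obtain ⟨i, rfl⟩ := Set.mem_range.1 ((List.mem_ofFn' f b).1 hb)
    exact hf i
  -- all `|D|^(R+1)` concatenations are distinct members of `Y`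
  have hsub : ((Fintype.piFinset fun _ : Fin (R + 1) => D).image
      fun f => (List.ofFn f).flatten) ⊆ Y := by
    intro w hw
    obtain ⟨f, hf, rfl⟩ := Finset.mem_image.1 hw
    have hf' := hblk f (Fintype.mem_piFinset.1 hf)
    refine hY _ (hmemL _ hf' (List.length_ofFn)) ?_
    rw [length_flatten_of_forall_length_eq _ (fun b hb => hlen b (hDF (hf' b hb))),
      List.length_ofFn, hN]
  have hinj : Set.InjOn (fun f : Fin (R + 1) → List Bool => (List.ofFn f).flatten)
      ↑(Fintype.piFinset fun _ : Fin (R + 1) => D) := by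
    intro f hf g hg hfg
    have hf' := hblk f (Fintype.mem_piFinset.1 (Finset.mem_coe.1 hf))
    have hg' := hblk g (Fintype.mem_piFinset.1 (Finset.mem_coe.1 hg))
    exact List.ofFn_injective (flatten_injective_of_length_eq _ _
      (fun b hb => hlen b (hDF (hf' b hb))) (fun b hb => hlen b (hDF (hg' b hb)))
      (by simp) hfg)
  have hDR : D.card ^ (R + 1) ≤ Y.card := by
    rw [← Fintype.card_piFinset_const D (R + 1), ← Finset.card_image_of_injOn hinj]
    exact Finset.card_le_card hsub
  calc F.card ^ (R + 1) ≤ (D.card * (2 ^ (S N + 1)) ^ R) ^ (R + 1) :=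
        Nat.pow_le_pow_left hcard _
    _ = D.card ^ (R + 1) * (2 ^ (S N + 1)) ^ ((R + 1) * R) := by
        rw [mul_pow, ← pow_mul, Nat.mul_comm R (R + 1)]
    _ ≤ Y.card * (2 ^ (S N + 1)) ^ ((R + 1) * R) := Nat.mul_le_mul_right _ hDR

/-- The repetition bound for a language in `USTREAM S T` (any `T`). [folklore] -/
theorem card_pow_le_of_replicate_mem_USTREAM {S T : ℕ → ℕ} {L : Language Bool}
    (hmem : L ∈ USTREAM S T) {N R ℓ : ℕ} (hR : 1 ≤ R) (hN : R * ℓ = N)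
    (F Y : Finset (List Bool)) (hlen : ∀ u ∈ F, u.length = ℓ)
    (hyes : ∀ u ∈ F, (List.replicate R u).flatten ∈ L)
    (hY : ∀ w ∈ L, w.length = N → w ∈ Y) :
    F.card ^ R ≤ Y.card * (2 ^ (S N + 1)) ^ (R * (R - 1)) := by
  obtain ⟨A, -, hS, -, -, hD⟩ := hmem
  exact card_pow_le_of_replicate_mem hS hD hR hN F Y hlen hyes hY

/-- The repetition bound for a language in the non-uniform class `STREAM S T` (any `T`).
[folklore] -/
theorem card_pow_le_of_replicate_mem_STREAM {S T : ℕ → ℕ} {L : Language Bool}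
    (hmem : L ∈ STREAM S T) {N R ℓ : ℕ} (hR : 1 ≤ R) (hN : R * ℓ = N)
    (F Y : Finset (List Bool)) (hlen : ∀ u ∈ F, u.length = ℓ)
    (hyes : ∀ u ∈ F, (List.replicate R u).flatten ∈ L)
    (hY : ∀ w ∈ L, w.length = N → w ∈ Y) :
    F.card ^ R ≤ Y.card * (2 ^ (S N + 1)) ^ (R * (R - 1)) := by
  obtain ⟨A, hS, -, hD⟩ := hmem
  exact card_pow_le_of_replicate_mem (runsInSpace_of_hasSpace hS) hD hR hN F Y hlen hyes hY

end Summit.PneNP.PneNP.Theorems.SoloBlind
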